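import Summits.Ventures.CertifiedManyBodySolver.Downfold.EmeryBoxesCupratesLowerFace
import HarnessLib

/-!
# Typed 3BE boxes of the INFINITE-LAYER cuprate Sr₀.₉La₀.₁CuO₂ (VSET #37, hold-out box #22): the DFT-own one-body box
# `emeryBoxSLCODFT` (U rows GAP ⇒ no six-box door) and the CLASS-TRANSFER solver-level box `emeryBoxSLCOClass`
# (CaCuO₂ «Ca11» MACE cGW-SIC xp-Hamiltonian members, lead ruling R-cn (ii)) — the first S2-bindable six-box for #37,
# grade `extrapolated`

Venture CertifiedManyBodySolver, cell `pub/hubbard-downfold` (stage S1 = ROUTER), seat hubbard-downfold-mod-4; namespace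
`Summit.Ventures.CertifiedManyBodySolver.Downfold`. Sequel of `EmeryBoxesCuprates` / `EmeryBoxesCupratesLowerFace` (typed La-214 and
Hg1201 boxes with their 64-vertex and 4-corner doors). Source rows: `router/BOXES/SrLaCuO2.md` §DFT-3b v1 (run-4, 2026-08-26T21:02Z:
DFT-level planar dpσ MLWF rows `Delta_pd_eV [1.08, 1.70]` (P0 ∪ P0pbe), `t_pd_eV [1.11, 1.32]`, `t_pp_eV [0.61, 0.73]`; `U_dd, U_pp, V_pd`
not computed) and §DFT-3b v1.2 addendum (run-4 g4, 2026-08-27T10:09Z; lead RULING R-cn (ii)): the printed three-orbital xp-Hamiltonian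
of CaCuO₂ at the cGW-SIC level (Morée, Hirayama, Schmid, Yamaji, Imada 2022, arXiv:2206.01510 App. A Table IV; AE δ 0 / PP δ 0 /
PP δ 0.1; lit-2 REFVALS-2 §34.8) ENTERS the hold-out box as FLAGGED CLASS-TRANSFER rows «class: CaCuO₂ infinite-layer (Ca11) →
Sr₀.₉La₀.₁CuO₂», hulled BY SOURCE WITHIN ONE LEVEL: `Delta_pd (cGW-SIC, CLASS) [2.10, 2.62]`, `t_pd [1.29, 1.36]`, `t_pp [0.74, 0.82]`,
`U_dd [8.88, 9.72]`, `U_pp [5.76, 6.30]`, `V_pd [2.20, 2.46]` eV; `router/EMERY-LINE-ROWS.tsv` v1.6 rows «M37 DFT-own» / «M37 cGW-SIC CLASS».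

* `emeryBoxSLCODFT` — the DFT-own one-body box (`tppP`, `Udd`, `Upp`, `Vpd` = `none`: GAP ⇒ constrains nothing); `_mem_iff`;
  `emeryBoxSLCODFT_gaps` (the three interaction entries are `none`, so the seam's six-box doors — which need `Udd`/`Upp` entries —
  do not apply: NOT S2-bindable, as EMERY-LINE prints);
* `emeryBoxSLCOClass` — the cGW-SIC CLASS box (all five seam entries located, grade `.extrapolated`; `tppP = none`); `_mem_iff`,
  `slcoClass_emeryLo / _emeryHi` (delivered six-box `[(1.29, 0.74, 2.10, 0, 8.88, 5.76), (1.36, 0.82, 2.62, 0, 9.72, 6.30)]` at εp = 0),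
  `_energyWord`, `_energyFloor` (64 vertices), `slcoClass_lowerFace` + `_energyFloor_lowerFace` (4 corners
  `(t_pd, t_pp) ∈ {1.29, 1.36} × {0.74, 0.82}` at `(ε_d, ε_p, U_d, U_p) = (2.10, 0, 8.88, 5.76)`), `slcoClass_widthBudget` (= 4.16 eV per
  site) + `_energy_sub_le`, `_cellFilling` (ρ = (6 − 0.9)/4 = 51/40: ELECTRON-doped, n_holes = 1 − x = 0.9), `_grade_extrapolated`,
  `_witness_mem` (the AE δ 0 set);
* `emeryBoxSLCO_levels_disjoint` — NO parameter vector lies in both boxes (DFT-level Δ ≤ 1.70 < 2.10 ≤ cGW-SIC Δ): the typed face of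
  the box writer's rule «a DFT-level Δ and a cGW-SIC-level Δ are different objects — both printed, never hulled across levels».

Everything here is PROVED (definitions with bodies; no `sorry`, no named fact). HONEST FRAMING: S1's SYSTEMATIC boxes typed verbatim;
the CLASS box is a class transfer from another material (a 3.85 vs 3.95 Å; x = 0.10 electron-doped target vs printed δ = 0 / 0.1
hole-doped sets — stated in the box) at SOLVER level (a consumer that solves it takes the cGW-SIC level object or states its
double-counting shift), hence grade `extrapolated`; typing certifies nothing about the material; hold-out discipline (no threshold, no
reading) is the box writer's and is untouched here. VERSION RULE: a later box revision that moves an edge gets a NEW definition.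
-/

namespace Summit.Ventures.CertifiedManyBodySolver.Downfold

open NonemptyInterval Literature.MathematicalPhysics.QuantumLattice

/-! ### `emeryBoxSLCODFT` — Sr₀.₉La₀.₁CuO₂, DFT-own one-body rows (SrLaCuO2.md §DFT-3b v1, P0 ∪ P0pbe) -/

/-- `DeltaPd`, DFT-level (ε_d − ε̄_p of the planar dpσ MLWFs, electron picture): [1.08, 1.70] eV = hull of P0 [1.08, 1.69] and P0pbe
[1.09, 1.70] (WAN:j258852 ⊕ FLOOR ±0.3). Source: router/BOXES/SrLaCuO2.md §DFT-3b v1 l.53/l.58; EMERY-LINE-ROWS.tsv row «M37 DFT-own». [folklore] -/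
def slcoDFTEmery_Delta : Entry := Entry.ofEnds (27/25) (17/10) (by norm_num) .screening
/-- `tpd`, DFT-level: [1.11, 1.32] eV (1.216 / 1.220 ⊕ FLOOR 8 %). Source: SrLaCuO2.md §DFT-3b v1 l.54/l.59. [folklore] -/
def slcoDFTEmery_tpd : Entry := Entry.ofEnds (111/100) (33/25) (by norm_num) .screening
/-- `tpp`, DFT-level: [0.61, 0.73] eV (0.673 / 0.674 ⊕ FLOOR 8 %). Source: SrLaCuO2.md §DFT-3b v1 l.55/l.60. [folklore] -/
def slcoDFTEmery_tpp : Entry := Entry.ofEnds (61/100) (73/100) (by norm_num) .screening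
/-- `nHoles`: n_holes = 1 − x = 0.90 per CuO₂ (ELECTRON-doped x = 0.10; the box's n line 1.10 e/Cu). Source: SrLaCuO2.md §DFT-1b
(n row) / EMERY-LINE-ROWS.tsv (n_holes [0.9, 0.9]). [folklore] -/
def slcoEmery_nH : Entry := Entry.ofEnds (9/10) (9/10) le_rfl .screening

/-- **The DFT-own one-body 3BE box of Sr₀.₉La₀.₁CuO₂** (`tppP`, `Udd`, `Upp`, `Vpd` not printed ⇒ `none`). [folklore] -/
def emeryBoxSLCODFT : EmeryBox := fun c =>
  match c with
  | .DeltaPd => some slcoDFTEmery_Delta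
  | .tpd => some slcoDFTEmery_tpd
  | .tpp => some slcoDFTEmery_tpp
  | .tppP => none
  | .Udd => none
  | .Upp => none
  | .Vpd => none
  | .nHoles => some slcoEmery_nH

/-- **Membership in `emeryBoxSLCODFT` unfolded** (only the located coordinates constrain). [folklore] -/
theorem emeryBoxSLCODFT_mem_iff (p : EmeryCoord → ℝ) :
    emeryBoxSLCODFT.Mem p ↔
      (((27/25) : ℚ) : ℝ) ≤ p .DeltaPd ∧ p .DeltaPd ≤ (((17/10) : ℚ) : ℝ) ∧
      (((111/100) : ℚ) : ℝ) ≤ p .tpd ∧ p .tpd ≤ (((33/25) : ℚ) : ℝ) ∧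
      (((61/100) : ℚ) : ℝ) ≤ p .tpp ∧ p .tpp ≤ (((73/100) : ℚ) : ℝ) ∧
      (((9/10) : ℚ) : ℝ) ≤ p .nHoles ∧ p .nHoles ≤ (((9/10) : ℚ) : ℝ) := by
  constructor
  · intro h
    have h0 := (Entry.mem_ofEnds_iff _ _ _ _ _).1 (h .DeltaPd slcoDFTEmery_Delta rfl)
    have h1 := (Entry.mem_ofEnds_iff _ _ _ _ _).1 (h .tpd slcoDFTEmery_tpd rfl)
    have h2 := (Entry.mem_ofEnds_iff _ _ _ _ _).1 (h .tpp slcoDFTEmery_tpp rfl)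
    have h7 := (Entry.mem_ofEnds_iff _ _ _ _ _).1 (h .nHoles slcoEmery_nH rfl)
    exact ⟨h0.1, h0.2, h1.1, h1.2, h2.1, h2.2, h7.1, h7.2⟩
  · rintro ⟨a0, b0, a1, b1, a2, b2, a7, b7⟩ i e hi
    cases i <;> simp only [emeryBoxSLCODFT, Option.some.injEq, reduceCtorEq] at hi <;> subst hi
    · exact (Entry.mem_ofEnds_iff _ _ _ _ _).2 ⟨a0, b0⟩
    · exact (Entry.mem_ofEnds_iff _ _ _ _ _).2 ⟨a1, b1⟩
    · exact (Entry.mem_ofEnds_iff _ _ _ _ _).2 ⟨a2, b2⟩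
    · exact (Entry.mem_ofEnds_iff _ _ _ _ _).2 ⟨a7, b7⟩

/-- **The GAPs of the DFT-own box, typed**: the interaction entries `Udd`, `Upp`, `Vpd` (and `tppP`) are `none`, so the seam's
six-box doors (`holdsOn_of_forall_emeryLineBox`, `holdsOn_emeryEnergyFloor`, which read `E .Udd = some _` and `E .Upp = some _`)
have no instance on this box — «NOT S2-bindable: GAP in U_dd, U_pp» of EMERY-LINE-ROWS row M37 DFT-own. [folklore] -/
theorem emeryBoxSLCODFT_gaps :
    emeryBoxSLCODFT .Udd = none ∧ emeryBoxSLCODFT .Upp = none ∧ emeryBoxSLCODFT .Vpd = none ∧ emeryBoxSLCODFT .tppP = none :=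
  ⟨rfl, rfl, rfl, rfl⟩

/-! ### `emeryBoxSLCOClass` — Sr₀.₉La₀.₁CuO₂, CLASS-TRANSFER cGW-SIC rows (CaCuO₂ xp-Hamiltonian, Morée 2022 Tab. IV; R-cn (ii)) -/

/-- `DeltaPd` (cGW-SIC level, CLASS): [2.10, 2.62] eV — by-source hull of ΔE_xp AE δ 0 2.62 · PP δ 0 2.36 · PP δ 0.1 2.10 (Morée
2022 App. A Tab. IV p.13); CLASS transfer CaCuO₂ → Sr₀.₉La₀.₁CuO₂ (lead R-cn (ii)); solver-level object (the GW-level 1.88–2.02 and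
GW+LRFB-level 0.77–1.02 Δ's of Tab. VI are DIFFERENT level objects printed in the box, not hulled here). Source:
router/BOXES/SrLaCuO2.md §DFT-3b v1.2 addendum l.64; EMERY-LINE-ROWS.tsv row «M37 cGW-SIC CLASS». [folklore] -/
def slcoClassEmery_Delta : Entry := Entry.ofEnds (21/10) (131/50) (by norm_num) .extrapolated
/-- `tpd` (cGW-SIC, CLASS): [1.29, 1.36] eV (|t_xp| AE 1.29 · PP 1.36 · PP δ 0.1 1.35). Source: SrLaCuO2.md §DFT-3b v1.2 l.67. [folklore] -/
def slcoClassEmery_tpd : Entry := Entry.ofEnds (129/100) (34/25) (by norm_num) .extrapolated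
/-- `tpp` (cGW-SIC, CLASS): [0.74, 0.82] eV (|t_pp| 0.74 · 0.77 · 0.82). Source: SrLaCuO2.md §DFT-3b v1.2 l.68. [folklore] -/
def slcoClassEmery_tpp : Entry := Entry.ofEnds (37/50) (41/50) (by norm_num) .extrapolated
/-- `Udd` (cGW-SIC, CLASS): [8.88, 9.72] eV (U_x AE 9.33 · PP 9.72 · PP δ 0.1 8.88). Source: SrLaCuO2.md §DFT-3b v1.2 l.69. [folklore] -/
def slcoClassEmery_Udd : Entry := Entry.ofEnds (222/25) (243/25) (by norm_num) .extrapolated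
/-- `Upp` (cGW-SIC, CLASS): [5.76, 6.30] eV (U_p 6.16 · 6.30 · 5.76). Source: SrLaCuO2.md §DFT-3b v1.2 l.70. [folklore] -/
def slcoClassEmery_Upp : Entry := Entry.ofEnds (144/25) (63/10) (by norm_num) .extrapolated
/-- `Vpd` (cGW-SIC, CLASS): [2.20, 2.46] eV (V_xp 2.35 · 2.46 · 2.20; no direction in the decorated model of record — carried as an
entry). Source: SrLaCuO2.md §DFT-3b v1.2 l.71. [folklore] -/
def slcoClassEmery_Vpd : Entry := Entry.ofEnds (11/5) (123/50) (by norm_num) .extrapolated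

/-- **The CLASS-TRANSFER cGW-SIC 3BE box of Sr₀.₉La₀.₁CuO₂** (`tppP` not printed ⇒ `none`; hole count of the TARGET material,
n_holes = 0.9). [folklore] -/
def emeryBoxSLCOClass : EmeryBox := fun c =>
  match c with
  | .DeltaPd => some slcoClassEmery_Delta
  | .tpd => some slcoClassEmery_tpd
  | .tpp => some slcoClassEmery_tpp
  | .tppP => none
  | .Udd => some slcoClassEmery_Udd
  | .Upp => some slcoClassEmery_Upp
  | .Vpd => some slcoClassEmery_Vpd
  | .nHoles => some slcoEmery_nH

/-- **Membership in `emeryBoxSLCOClass` unfolded.** [folklore] -/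
theorem emeryBoxSLCOClass_mem_iff (p : EmeryCoord → ℝ) :
    emeryBoxSLCOClass.Mem p ↔
      (((21/10) : ℚ) : ℝ) ≤ p .DeltaPd ∧ p .DeltaPd ≤ (((131/50) : ℚ) : ℝ) ∧
      (((129/100) : ℚ) : ℝ) ≤ p .tpd ∧ p .tpd ≤ (((34/25) : ℚ) : ℝ) ∧
      (((37/50) : ℚ) : ℝ) ≤ p .tpp ∧ p .tpp ≤ (((41/50) : ℚ) : ℝ) ∧
      (((222/25) : ℚ) : ℝ) ≤ p .Udd ∧ p .Udd ≤ (((243/25) : ℚ) : ℝ) ∧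
      (((144/25) : ℚ) : ℝ) ≤ p .Upp ∧ p .Upp ≤ (((63/10) : ℚ) : ℝ) ∧
      (((11/5) : ℚ) : ℝ) ≤ p .Vpd ∧ p .Vpd ≤ (((123/50) : ℚ) : ℝ) ∧
      (((9/10) : ℚ) : ℝ) ≤ p .nHoles ∧ p .nHoles ≤ (((9/10) : ℚ) : ℝ) := by
  constructor
  · intro h
    have h0 := (Entry.mem_ofEnds_iff _ _ _ _ _).1 (h .DeltaPd slcoClassEmery_Delta rfl)
    have h1 := (Entry.mem_ofEnds_iff _ _ _ _ _).1 (h .tpd slcoClassEmery_tpd rfl)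
    have h2 := (Entry.mem_ofEnds_iff _ _ _ _ _).1 (h .tpp slcoClassEmery_tpp rfl)
    have h4 := (Entry.mem_ofEnds_iff _ _ _ _ _).1 (h .Udd slcoClassEmery_Udd rfl)
    have h5 := (Entry.mem_ofEnds_iff _ _ _ _ _).1 (h .Upp slcoClassEmery_Upp rfl)
    have h6 := (Entry.mem_ofEnds_iff _ _ _ _ _).1 (h .Vpd slcoClassEmery_Vpd rfl)
    have h7 := (Entry.mem_ofEnds_iff _ _ _ _ _).1 (h .nHoles slcoEmery_nH rfl)
    exact ⟨h0.1, h0.2, h1.1, h1.2, h2.1, h2.2, h4.1, h4.2, h5.1, h5.2, h6.1, h6.2, h7.1, h7.2⟩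
  · rintro ⟨a0, b0, a1, b1, a2, b2, a4, b4, a5, b5, a6, b6, a7, b7⟩ i e hi
    cases i <;> simp only [emeryBoxSLCOClass, Option.some.injEq, reduceCtorEq] at hi <;> subst hi
    · exact (Entry.mem_ofEnds_iff _ _ _ _ _).2 ⟨a0, b0⟩
    · exact (Entry.mem_ofEnds_iff _ _ _ _ _).2 ⟨a1, b1⟩
    · exact (Entry.mem_ofEnds_iff _ _ _ _ _).2 ⟨a2, b2⟩
    · exact (Entry.mem_ofEnds_iff _ _ _ _ _).2 ⟨a4, b4⟩
    · exact (Entry.mem_ofEnds_iff _ _ _ _ _).2 ⟨a5, b5⟩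
    · exact (Entry.mem_ofEnds_iff _ _ _ _ _).2 ⟨a6, b6⟩
    · exact (Entry.mem_ofEnds_iff _ _ _ _ _).2 ⟨a7, b7⟩

/-- **Every located PARAMETER entry of the CLASS box carries grade `extrapolated`** (class transfer + solver level; the hole count is
the target's own, `screening`). [folklore] -/
theorem emeryBoxSLCOClass_grade_extrapolated (c : EmeryCoord) (e : Entry) (hc : emeryBoxSLCOClass c = some e)
    (hn : c ≠ .nHoles) : e.grade = .extrapolated := by
  cases c <;> simp only [emeryBoxSLCOClass, Option.some.injEq, reduceCtorEq] at hc <;> first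
    | exact absurd rfl hn
    | (subst hc; rfl)

/-- Lower corner of the delivered six-box of `emeryBoxSLCOClass` at `εp = 0`, order `(t_pd, t_pp, ε_d, ε_p, U_d, U_p)`:
`(129/100, 37/50, 21/10, 0, 222/25, 144/25)`. [folklore] -/
theorem slcoClass_emeryLo : emeryLo 0 slcoClassEmery_tpd slcoClassEmery_tpp slcoClassEmery_Delta slcoClassEmery_Udd
    slcoClassEmery_Upp = ![129/100, 37/50, 21/10, 0, 222/25, 144/25] := by
  ext i; fin_cases i <;>
    simp [emeryLo, slcoClassEmery_tpd, slcoClassEmery_tpp, slcoClassEmery_Delta, slcoClassEmery_Udd, slcoClassEmery_Upp]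

/-- Upper corner of the delivered six-box of `emeryBoxSLCOClass` at `εp = 0`: `(34/25, 41/50, 131/50, 0, 243/25, 63/10)`. [folklore] -/
theorem slcoClass_emeryHi : emeryHi 0 slcoClassEmery_tpd slcoClassEmery_tpp slcoClassEmery_Delta slcoClassEmery_Udd
    slcoClassEmery_Upp = ![34/25, 41/50, 131/50, 0, 243/25, 63/10] := by
  ext i; fin_cases i <;>
    simp [emeryHi, slcoClassEmery_tpd, slcoClassEmery_tpp, slcoClassEmery_Delta, slcoClassEmery_Udd, slcoClassEmery_Upp]

/-- **S2 box statement ⇒ box word on `emeryBoxSLCOClass`**: any statement `∀ q ∈ Set.Icc (129/100, 37/50, 21/10, 0, 222/25, 144/25)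
(34/25, 41/50, 131/50, 0, 243/25, 63/10), W q` about the numeric six-box (reference level `εp = 0`) holds on the box as
`p ↦ W (emeryLineCoords 0 p)`. [folklore] -/
theorem emeryBoxSLCOClass_energyWord {W : (Fin 6 → ℝ) → Prop}
    (hW : ∀ q ∈ Set.Icc (![129/100, 37/50, 21/10, 0, 222/25, 144/25] : Fin 6 → ℝ) ![34/25, 41/50, 131/50, 0, 243/25, 63/10], W q) :
    HoldsOn (fun p : EmeryCoord → ℝ => W (emeryLineCoords 0 p)) emeryBoxSLCOClass := by
  have h := holdsOn_of_forall_emeryLineBox (E := emeryBoxSLCOClass) (εp := 0) (eA := slcoClassEmery_tpd)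
    (eB := slcoClassEmery_tpp) (eD := slcoClassEmery_Delta) (eUd := slcoClassEmery_Udd) (eUp := slcoClassEmery_Upp)
    rfl rfl rfl rfl rfl (W := W) (by rw [slcoClass_emeryLo, slcoClass_emeryHi]; exact hW)
  simpa using h

/-- **Vertex-certified three-band energy floor on `emeryBoxSLCOClass`**: a floor `m ≤ e(emeryLine s v, ρ)` certified at the `64`
vertices of `[(129/100, 37/50, 21/10, 0, 222/25, 144/25), (34/25, 41/50, 131/50, 0, 243/25, 63/10)]` holds at every parameter vector of
the box (any O–O sign pattern `s`, any cell filling `ρ`). [cite: Israel1979, Thm. I.3.4] -/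
theorem emeryBoxSLCOClass_energyFloor (s : Fin 4 → ℝ) (ρ : ℝ) {m : ℝ}
    (hm : ∀ v ∈ Fintype.piFinset (fun i => ({(![129/100, 37/50, 21/10, 0, 222/25, 144/25] : Fin 6 → ℝ) i,
        (![34/25, 41/50, 131/50, 0, 243/25, 63/10] : Fin 6 → ℝ) i} : Finset ℝ)),
      m ≤ emeryEnergyDensity (emeryLine s v) ρ) :
    HoldsOn (fun p : EmeryCoord → ℝ => m ≤ emeryEnergyDensity (emeryLine s (emeryLineCoords 0 p)) ρ) emeryBoxSLCOClass := by
  have h := holdsOn_emeryEnergyFloor (E := emeryBoxSLCOClass) (εp := 0) (eA := slcoClassEmery_tpd) (eB := slcoClassEmery_tpp)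
    (eD := slcoClassEmery_Delta) (eUd := slcoClassEmery_Udd) (eUp := slcoClassEmery_Upp) rfl rfl rfl rfl rfl s ρ (m := m)
    (by rw [slcoClass_emeryLo, slcoClass_emeryHi]; exact hm)
  simpa using h

/-- The LOWER FACE of the SLCO class six-box: `(34/25, 41/50, 21/10, 0, 222/25, 144/25)` (hopping coordinates free, the four
monotone coordinates pinned at their lower ends). [folklore] -/
theorem slcoClass_lowerFace :
    lowerFace (![129/100, 37/50, 21/10, 0, 222/25, 144/25] : Fin 6 → ℝ) ![34/25, 41/50, 131/50, 0, 243/25, 63/10] =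
      ![34/25, 41/50, 21/10, 0, 222/25, 144/25] := by
  ext i; fin_cases i <;> simp [lowerFace]

/-- **Four corner certificates bind `emeryBoxSLCOClass`** (lower-face rule of `EmeryMonotoneVertexFloors`): if an S2 producer certifies
`m ≤ e(emeryLine s v, ρ)` at the vertices of `Set.Icc (129/100, 37/50, 21/10, 0, 222/25, 144/25) (34/25, 41/50, 21/10, 0, 222/25, 144/25)`
(the 4 corners `(t_pd, t_pp) ∈ {1.29, 1.36} × {0.74, 0.82}` at `ε_d = 2.10, ε_p = 0, U_d = 8.88, U_p = 5.76`), the floor holds at every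
parameter vector of the box. [cite: Israel1979, Thm. I.3.4] -/
theorem emeryBoxSLCOClass_energyFloor_lowerFace (s : Fin 4 → ℝ) (ρ : ℝ) {m : ℝ}
    (hm : ∀ v ∈ Fintype.piFinset (fun i => ({(![129/100, 37/50, 21/10, 0, 222/25, 144/25] : Fin 6 → ℝ) i,
        (![34/25, 41/50, 21/10, 0, 222/25, 144/25] : Fin 6 → ℝ) i} : Finset ℝ)),
      m ≤ emeryEnergyDensity (emeryLine s v) ρ) :
    HoldsOn (fun p : EmeryCoord → ℝ => m ≤ emeryEnergyDensity (emeryLine s (emeryLineCoords 0 p)) ρ) emeryBoxSLCOClass := by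
  have h := holdsOn_emeryEnergyFloor_lowerFace (E := emeryBoxSLCOClass) (εp := 0) (eA := slcoClassEmery_tpd)
    (eB := slcoClassEmery_tpp) (eD := slcoClassEmery_Delta) (eUd := slcoClassEmery_Udd) (eUp := slcoClassEmery_Upp)
    rfl rfl rfl rfl rfl s ρ (m := m) (by rw [slcoClass_emeryLo, slcoClass_emeryHi, slcoClass_lowerFace]; exact hm)
  simpa using h

/-- **The Lipschitz energy price of the width of `emeryBoxSLCOClass`**: `8·w(t_pd) + 8·w(t_pp) + 2·w(Δ_pd) + w(U_dd) + 2·w(U_pp)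
= 8·0.07 + 8·0.08 + 2·0.52 + 0.84 + 2·0.54 = 4.16 = 104/25` eV per site (the tightest 3BE six-box typed so far: La-214 14.02, Hg1201
9.78). [folklore] -/
theorem slcoClass_widthBudget :
    8 * slcoClassEmery_tpd.widthR + 8 * slcoClassEmery_tpp.widthR + 2 * slcoClassEmery_Delta.widthR + slcoClassEmery_Udd.widthR +
        2 * slcoClassEmery_Upp.widthR = ((104/25 : ℚ) : ℝ) := by
  simp only [Entry.widthR, slcoClassEmery_tpd, slcoClassEmery_tpp, slcoClassEmery_Delta, slcoClassEmery_Udd, slcoClassEmery_Upp,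
    Entry.encl_ofEnds_fst, Entry.encl_ofEnds_snd]
  push_cast; norm_num

/-- **Two parameter vectors of `emeryBoxSLCOClass` differ in certified three-band energy density by at most `4.16`** (unit sign
pattern, common reference level, realised filling). [cite: Israel1979, Thm. I.3.4] -/
theorem emeryBoxSLCOClass_energy_sub_le {ρ : ℝ} (hne : (emeryStates ρ).Nonempty) {s : Fin 4 → ℝ} (hs : ∀ i, |s i| ≤ 1)
    (εp : ℝ) {p p' : EmeryCoord → ℝ} (hp : emeryBoxSLCOClass.Mem p) (hp' : emeryBoxSLCOClass.Mem p') :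
    |emeryEnergyDensity (emeryLine s (emeryLineCoords εp p)) ρ -
        emeryEnergyDensity (emeryLine s (emeryLineCoords εp p')) ρ| ≤ ((104/25 : ℚ) : ℝ) := by
  rw [← slcoClass_widthBudget]
  exact abs_emeryEnergyDensity_sub_le_of_mem_emeryLineBox (E := emeryBoxSLCOClass) rfl rfl rfl rfl rfl hne hs εp hp hp'

/-- **Cell filling of `emeryBoxSLCOClass`**: `ρ = (6 − n_holes)/4 = (6 − 9/10)/4 = 51/40` (electron-doped: above the parent's 5/4).
[folklore] -/
theorem emeryBoxSLCOClass_cellFilling {p : EmeryCoord → ℝ} (hp : emeryBoxSLCOClass.Mem p) :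
    emeryCellFilling p ∈ Set.Icc ((((6 : ℚ) - 9/10) / 4 : ℚ) : ℝ) ((((6 : ℚ) - 9/10) / 4 : ℚ) : ℝ) := by
  have h := emeryCellFilling_mem_Icc (E := emeryBoxSLCOClass) (eN := slcoEmery_nH) rfl hp
  simpa [slcoEmery_nH] using h

/-- **Cell filling of `emeryBoxSLCODFT`** (same hole count): `ρ = 51/40`. [folklore] -/
theorem emeryBoxSLCODFT_cellFilling {p : EmeryCoord → ℝ} (hp : emeryBoxSLCODFT.Mem p) :
    emeryCellFilling p ∈ Set.Icc ((((6 : ℚ) - 9/10) / 4 : ℚ) : ℝ) ((((6 : ℚ) - 9/10) / 4 : ℚ) : ℝ) := by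
  have h := emeryCellFilling_mem_Icc (E := emeryBoxSLCODFT) (eN := slcoEmery_nH) rfl hp
  simpa [slcoEmery_nH] using h

/-- **Non-vacuity witness of the CLASS box**: the AE δ 0 member (ΔE_xp 2.62, |t_xp| 1.29, |t_pp| 0.74, U_x 9.33, U_p 6.16, V_xp 2.35)
at the target's hole count 0.9 (t_pp′ unconstrained, set to 0). [folklore] -/
theorem emeryBoxSLCOClass_witness_mem :
    emeryBoxSLCOClass.Mem (fun c => match c with
      | .DeltaPd => (((131/50) : ℚ) : ℝ)
      | .tpd => (((129/100) : ℚ) : ℝ)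
      | .tpp => (((37/50) : ℚ) : ℝ)
      | .tppP => (((0) : ℚ) : ℝ)
      | .Udd => (((933/100) : ℚ) : ℝ)
      | .Upp => (((154/25) : ℚ) : ℝ)
      | .Vpd => (((47/20) : ℚ) : ℝ)
      | .nHoles => (((9/10) : ℚ) : ℝ)
      ) := by
  rw [emeryBoxSLCOClass_mem_iff]
  refine ⟨?_, ?_, ?_, ?_, ?_, ?_, ?_, ?_, ?_, ?_, ?_, ?_, ?_, ?_⟩ <;> exact_mod_cast (by norm_num)

/-- **Non-vacuity witness of the DFT-own box**: run-4's P0 set (Δ 1.388, t_pd 1.216, t_pp 0.673) at n_holes 0.9. [folklore] -/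
theorem emeryBoxSLCODFT_witness_mem :
    emeryBoxSLCODFT.Mem (fun c => match c with
      | .DeltaPd => (((347/250) : ℚ) : ℝ)
      | .tpd => (((152/125) : ℚ) : ℝ)
      | .tpp => (((673/1000) : ℚ) : ℝ)
      | .tppP => (((0) : ℚ) : ℝ)
      | .Udd => (((0) : ℚ) : ℝ)
      | .Upp => (((0) : ℚ) : ℝ)
      | .Vpd => (((0) : ℚ) : ℝ)
      | .nHoles => (((9/10) : ℚ) : ℝ)
      ) := by
  rw [emeryBoxSLCODFT_mem_iff]
  refine ⟨?_, ?_, ?_, ?_, ?_, ?_, ?_, ?_⟩ <;> exact_mod_cast (by norm_num)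

/-- **The two level objects are DISJOINT boxes**: no parameter vector is a member of both the DFT-own box (Δ_pd ≤ 1.70) and the
cGW-SIC CLASS box (Δ_pd ≥ 2.10) — the typed form of «never hulled across levels» (SrLaCuO2.md §DFT-3b v1.2): a word certified on
one box says nothing about the other, and their union is not a box of record. [folklore] -/
theorem emeryBoxSLCO_levels_disjoint (p : EmeryCoord → ℝ) : ¬ (emeryBoxSLCODFT.Mem p ∧ emeryBoxSLCOClass.Mem p) := by
  rintro ⟨hD, hC⟩
  rw [emeryBoxSLCODFT_mem_iff] at hD
  rw [emeryBoxSLCOClass_mem_iff] at hC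
  obtain ⟨-, b0, -⟩ := hD
  obtain ⟨a0, -⟩ := hC
  have h : (((21/10) : ℚ) : ℝ) ≤ (((17/10) : ℚ) : ℝ) := a0.trans b0
  revert h
  push_cast
  norm_num

end Summit.Ventures.CertifiedManyBodySolver.Downfold
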